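import Summits.BirchSwinnertonDyer.BirchSwinnertonDyer.Theorems.GenusKolyvaginAtTwoGenusDeepSupplyAtTwoNegDiscNarrowDepthZeroAntiInvariantRational
import Summits.BirchSwinnertonDyer.BirchSwinnertonDyer.Theorems.GenusKolyvaginAtTwoGenusDeepSupplyAtTwoNegDiscNarrowDepthZeroInstance
import HarnessLib

/-!
# Route `GenusKolyvaginAtTwo`, crux `GenusDeepSupplyAtTwoNegDiscNarrow` (stmt-BirchSwinnertonDyer-23491): **K₁ ⟹ R₁** —
# on the `#Sel₂(E) = 1` cell of the PRIME Heegner twin, `y_K ∉ 2E(K[1])` forces the LEAD's REDUCTION BIT at the ramified prime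

Width seat `bsd-line-gk2-p4` g25 (cell `bsd-f1-sign2`), `--supports stmt-BirchSwinnertonDyer-23491` (helper; closes nothing).
THEOREMS ONLY (no definition, no named fact, no `sorry`); **BSD is NOT proved by any of this; no item is closed.**

CONTEXT. Sixth and last file of Claim B of the LEAD's depth-zero reduction criterion (`DEPTH-ZERO-REDUCTION-CRITERION-g21.md` §2):
the converse of gk2-p5 g33's `depth_eq_zero_of_geomReduction_ne` (R₁ ⟹ `M₀ = 0`, i.e. R₁ ⟹ K₁) on the sub-frame the supply actually
produces (`d_K = −ℓ₀` prime, `ℓ₀ ≡ 7 (8)`). Assembled from `…DepthZeroAntiInvariantRational` (an anti-invariant `Y ∈ E(K) ∖ 2E(K)` has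
`red_𝔓(e_*Y) ≠ Õ` — itself the composite of the global half p763963, the local Kummer reading p764224, the twisted local reading p764388
and the sign/descent dictionary p764523) and the Gross 5.3 bookkeeping of g33's `…DepthZeroInstance`:

* **`reductionBit_of_not_two_dvd_derivedPoint_prime`** — `W/ℚ` globally minimal elliptic with `Δ_W < 0`, `r_an(W) = 0`, `ρ̄_{W,2}`
  onto, `#Sel₂(W) = 1`; `K` imaginary quadratic with `d_K = −ℓ` (`ℓ` an odd prime), Heegner for `N_W`, `d_K·Δ_W ∉ ℚ²`; a conductor-`1`
  Kolyvagin–Heegner datum `d₁` with **`y_K = P(1) ∉ 2E(K[1])`** (K₁: `M₀ = 0`). THEN **R₁**: `ℓ ∤ Δ_min(W)` and there is `P₀ ∈ E(K)`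
  over `P(1)` with `red_𝔓(e_*P₀) ≠ red_𝔓(e_*s)` for EVERY `Aut(K/ℚ)`-fixed torsion point `s ∈ E(K)` — verbatim the conclusion of
  the binder `hR1` of `DepthZero.nonCMAtTwo_of_items_of_reductionBits` at this `K`.
  Proof: `t₀ = τP₀ + P₀` is torsion (Gross 5.3, `w = +1`) of odd order (`E(K)[2] = 0`), `s₀ = ((m+1)/2)·t₀`, `Y = P₀ − s₀` is
  anti-invariant and `∉ 2E(K)` (else `P₀ = 2(Q + ((m+1)/2)s₀)` and `y_K ∈ 2E(K[1])`); so `red(e_*Y) ≠ Õ`; but `2·red(e_*Y) =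
  red(e_*P₀) − red(γ·e_*P₀) = Õ` for the inertia element `γ ↦ τ`, and `red(e_*(s₀ − s))` has odd order — so `red(e_*P₀) = red(e_*s)`
  would make `red(e_*Y)` an element of odd order killed by `2`, i.e. `Õ`.

So on the prime-Heegner `#Sel₂(E) = 1` cell **K₁ ⟺ R₁** (with g33's p762289): itemising the reduction bit loses nothing there.

References: [GrossLMS1991] §5 Prop. 5.3, §4 (4.1); [McCallumLMS1991] §5 Lemma 5.1; [MazurRubin2010] Prop. 3.3, Cor. 3.4 (i);
[SilvermanAEC2009] X.5 Cor. 5.4, VIII §1–§2, VII.3.1; [SerreLocalFields1979] I §7.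
-/

set_option autoImplicit false
set_option linter.dupNamespace false -- `Summit.<P>.<Sub>` repeats `BirchSwinnertonDyer` (D-0017)

noncomputable section

open scoped Classical NumberField Pointwise

namespace Summit.BirchSwinnertonDyer.BirchSwinnertonDyer.Theorems.GenusSupplyNarrow.DepthZero

open IsDedekindDomain Field NumberField WeierstrassCurve Literature.NumberTheory.EllipticCurves
  Literature.NumberTheory.EllipticCurves.ModularForms Literature.NumberTheory.GaloisRepresentations Rat.HeightOneSpectrum
  Summit.BirchSwinnertonDyer.BirchSwinnertonDyer.Theorems.GenusSupplyNarrow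

variable {K : Type} [Field K] [NumberField K]

/-- In an additive commutative group, an element of odd order killed by `2` is `0`. [folklore] -/
private theorem eq_zero_of_two_smul_eq_zero_of_odd_addOrderOf {A : Type*} [AddCommGroup A] {x : A}
    (h2 : (2 : ℤ) • x = 0) (hodd : Odd (addOrderOf x)) : x = 0 := by
  have hdvd : addOrderOf x ∣ 2 := by
    apply addOrderOf_dvd_of_nsmul_eq_zero
    rw [← natCast_zsmul]
    exact_mod_cast h2
  rcases (Nat.dvd_prime Nat.prime_two).mp hdvd with h1 | h2'
  · exact AddMonoid.addOrderOf_eq_one_iff.mp h1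
  · exfalso
    rw [h2'] at hodd
    exact (Nat.not_even_iff_odd.mpr hodd) even_two

/-- **K₁ ⟹ R₁ ON THE PRIME-HEEGNER `#Sel₂(E) = 1` CELL.** `W/ℚ` globally minimal elliptic with `Δ_W < 0`, `r_an(W) = 0` (so `w = +1`),
`ρ̄_{W,2}` onto, `#Sel₂(W) = 1`; `K` imaginary quadratic with `d_K = −ℓ`, `ℓ` an odd prime (a PRIME Heegner field of the supply), Heegner
for `N_W`, `d_K·Δ_W ∉ ℚ²` (so `E(K[1])[2] = 0`); `d₁` a conductor-`1` Kolyvagin–Heegner datum whose point `y_K = P(1)` is NOT halvable in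
`E(K[1])` (the kernel K₁, `M₀ = 0`). THEN `ℓ ∤ Δ_min(W)` and for some `P₀ ∈ E(K)` over `P(1)`, **`red_𝔓(e_*P₀) ≠ red_𝔓(e_*s)` for every
`Aut(K/ℚ)`-fixed torsion `s ∈ E(K)`** — the reduction bit R₁ (`hR1` of `nonCMAtTwo_of_items_of_reductionBits`) at this `K`, `ℓ`.
[cite: GrossLMS1991, §5 Prop. 5.3, §4 (4.1)] [cite: MazurRubin2010, Prop. 3.3, Cor. 3.4 (i)] [cite: SilvermanAEC2009, X.5 Cor. 5.4, VII.3.1] -/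
theorem reductionBit_of_not_two_dvd_derivedPoint_prime (W : WeierstrassCurve ℚ) [W.IsElliptic] [W.IsGloballyMinimal]
    [NeZero (W.conductorNorm ℤ)] (hΔneg : W.Δ < 0) (hr0 : W.analyticRank = 0) (hρ : W.HasSurjectiveModNGaloisRep 2)
    (h1 : Nat.card (W.selmerGroup 2) = 1)
    (hK : IsImaginaryQuadratic K) (hH : SatisfiesHeegnerHypothesis (W.conductorNorm ℤ) K)
    (hsq : ¬ IsSquare ((NumberField.discr K : ℚ) * W.Δ))
    {ℓ : ℕ} [Fact ℓ.Prime] (hℓ2 : ℓ ≠ 2) (hd : NumberField.discr K = -(ℓ : ℤ))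
    (Dt : ModularParametrizationData W (W.conductorNorm ℤ)) (β : ℤ) (ι : K →+* ℂ) (d₁ : KolyvaginHeegnerData Dt β ι 1)
    (hK1 : ¬ ∃ Q : (W.baseChange (ringClassField K ι 1)).toAffine.Point, (2 : ℤ) • Q = d₁.derivedPoint) :
    ∃ (hΔ : ¬ (ℓ : ℤ) ∣ minimalDiscriminantInt W) (P₀ : (W.baseChange K).toAffine.Point),
      Affine.Point.map (W' := W) (algebraMap K (ringClassField K ι 1)).toRatAlgHom P₀ = d₁.derivedPoint ∧
      ∀ s : (W.baseChange K).toAffine.Point, IsOfFinAddOrder s → (∀ σ : K ≃ₐ[ℚ] K, σ • s = s) →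
        geomReduction hΔ (Affine.Point.map (W' := W) (absEmbedding ℚ K) P₀ : W.geomPoints) ≠
          geomReduction hΔ (Affine.Point.map (W' := W) (absEmbedding ℚ K) s : W.geomPoints) := by
  have hℓ : ℓ.Prime := Fact.out
  have h2 : Module.finrank ℚ K = 2 := hK.1
  haveI : Algebra.IsQuadraticExtension ℚ K := ⟨h2⟩
  haveI : IsGalois ℚ K := inferInstance
  have hcard : Nat.card (K ≃ₐ[ℚ] K) = 2 := by rw [IsGalois.card_aut_eq_finrank, h2]
  have hℓd : (ℓ : ℤ) ∣ NumberField.discr K := ⟨-1, by rw [hd]; ring⟩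
  have hΔ : ¬ (ℓ : ℤ) ∣ minimalDiscriminantInt W := not_dvd_minimalDiscriminantInt_of_discr_eq_neg_prime W hK hH hℓ hℓ2 hd
  refine ⟨hΔ, ?_⟩
  -- `E(K[1])[2] = 0`, hence `E(K)[2] = 0`
  have htors : ∀ T : (W.baseChange (ringClassField K ι 1)).toAffine.Point, (2 : ℤ) • T = 0 → T = 0 := by
    intro T hT
    have h := GenusExact.torsionBy_two_ringClassField_eq_bot W hK ι one_ne_zero hρ hsq
    have hT' : T ∈ AddSubgroup.torsionBy (W.baseChange (ringClassField K ι 1)).toAffine.Point ((2 : ℕ) : ℤ) :=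
      (Submodule.mem_torsionBy_iff _ T).mpr (by exact_mod_cast hT)
    rw [h] at hT'
    exact (AddSubgroup.mem_bot).mp hT'
  set i : (W.baseChange K).toAffine.Point →+ (W.baseChange (ringClassField K ι 1)).toAffine.Point :=
    Affine.Point.map (W' := W) (algebraMap K (ringClassField K ι 1)).toRatAlgHom with hi
  have hiinj : Function.Injective i := Affine.Point.map_injective (W' := W) _
  have h2K : ∀ T : (W.baseChange K).toAffine.Point, (2 : ℤ) • T = 0 → T = 0 := by
    intro T hT
    apply hiinj
    rw [map_zero]
    exact htors _ (by rw [← map_zsmul, hT, map_zero])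
  -- `P₀ ∈ E(K)` over `P(1)`: a Heegner point
  obtain ⟨P₀, hP₀H, hP₀⟩ := heegnerSystem_exists_isHeegnerPoint_map_eq_derivedPoint_one
    (heegnerPointOfConductor_one_galoisConj_holds (W.conductorNorm ℤ) W K) hK hH d₁
  refine ⟨P₀, hP₀, fun s hsfin _hsfix hred ↦ ?_⟩
  -- `w(E) = +1`; the non-trivial automorphism `τ`; Gross 5.3: `t₀ = τP₀ + P₀` is torsion
  have hw1 : W.rootNumber = 1 := W.rootNumber_eq_one_of_even_analyticRank (by rw [hr0]; exact Even.zero)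
  obtain ⟨v, hv⟩ : ∃ v : HeightOneSpectrum (𝓞 ℚ), (primesEquiv v : ℕ) = ℓ :=
    ⟨primesEquiv.symm ⟨ℓ, Fact.out⟩, by rw [Equiv.apply_symm_apply]⟩
  obtain ⟨𝔓, hmem, h𝔓⟩ := exists_ideal_placeOver (p := ℓ) hv
  obtain ⟨γ, hγI, τ, hτ1, hγ⟩ := exists_mem_inertia_smul_absEmbedding_eq h2 hℓd hv h𝔓
  have hττ : τ * τ = 1 := by
    rcases Literature.NumberTheory.QuadraticFields.eq_one_or_eq_of_card_eq_two hcard hτ1 (τ * τ) with h | h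
    · exact h
    · exact absurd (mul_left_cancel (a := τ) (h.trans (mul_one τ).symm)) hτ1
  obtain ⟨e, he⟩ : ∃ e : (W.baseChange K).toAffine.Point →+ W.geomPoints,
      e = Affine.Point.map (W' := W) (absEmbedding ℚ K) := ⟨_, rfl⟩
  have heinj : Function.Injective e := by rw [he]; exact Affine.Point.map_injective (W' := W) _
  have hequiv : ∀ R : (W.baseChange K).toAffine.Point, γ • e R = e (τ • R) := fun R ↦ by
    rw [he]; exact smul_eq_map_absEmbedding_smul W hγ R _ rfl
  have hσ : (τ : K →ₐ[ℚ] K) ≠ AlgHom.id ℚ K := fun h ↦ hτ1 (AlgEquiv.ext fun x ↦ DFunLike.congr_fun h x)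
  set t₀ : (W.baseChange K).toAffine.Point := τ • P₀ + P₀ with ht₀
  have ht₀fin : IsOfFinAddOrder t₀ := by
    have h := heegnerPoint_conj_add_rootNumber_smul.apply heegnerPoint_conj_add_rootNumber_smul_holds hK hH hP₀H hσ
    rwa [hw1, one_smul, ← WeierstrassCurve.smul_def W K τ P₀] at h
  have hτt₀ : τ • t₀ = t₀ := by
    rw [ht₀, smul_add, ← mul_smul, hττ, one_smul, add_comm]
  -- `t₀` has odd order `m`; `s₀ = ((m+1)/2)·t₀` with `2s₀ = t₀`
  have hodd : Odd (addOrderOf t₀) :=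
    odd_addOrderOf_of_two_torsionFree ht₀fin fun k hk ↦ h2K _ hk
  obtain ⟨m', hm'⟩ := hodd
  set c : ℤ := (m' : ℤ) + 1 with hc
  set s₀ : (W.baseChange K).toAffine.Point := c • t₀ with hs₀
  have hs₀fin : IsOfFinAddOrder s₀ := ht₀fin.zsmul
  have h2s₀ : (2 : ℤ) • s₀ = t₀ := by
    have hcm : (2 : ℤ) * c = (addOrderOf t₀ : ℤ) + 1 := by rw [hc, hm']; push_cast; ring
    rw [hs₀, smul_smul, hcm, add_zsmul, one_zsmul, natCast_zsmul, addOrderOf_nsmul_eq_zero, zero_add]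
  have hsm : τ • (c • t₀) = c • (τ • t₀) :=
    map_zsmul (DistribSMul.toAddMonoidHom ((W.baseChange K).toAffine.Point) τ) c t₀
  have hτs₀ : τ • s₀ = s₀ := by rw [hs₀, hsm, hτt₀]
  -- the anti-invariant point `Y = P₀ − s₀`
  set Y : (W.baseChange K).toAffine.Point := P₀ - s₀ with hY
  have hanti : τ • Y = -Y := by
    have hτP : τ • P₀ = -P₀ + t₀ := by rw [ht₀]; abel
    rw [hY, smul_sub, hτs₀, hτP, ← h2s₀, two_zsmul]
    abel
  -- `Y ∉ 2E(K)` (else `y_K ∈ 2E(K[1])`)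
  have hY2 : ¬ ∃ Q : (W.baseChange K).toAffine.Point, (2 : ℤ) • Q = Y := by
    rintro ⟨Q, hQ⟩
    apply hK1
    refine ⟨i (Q + c • s₀), ?_⟩
    rw [← map_zsmul, ← hP₀]
    change i ((2 : ℤ) • (Q + c • s₀)) = i P₀
    congr 1
    have : (2 : ℤ) • (c • s₀) = s₀ := by rw [smul_comm, h2s₀]
    rw [zsmul_add, hQ, this, hY, sub_add_cancel]
  -- Claim B on the curve: `red(e_*Y) ≠ Õ`
  have hredY := geomReduction_map_absEmbedding_ne_zero_of_anti_of_not_two_dvd W hΔneg hK hH hℓ2 hd h1 hτ1 hanti hY2 hΔ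
  -- `2 · red(e_*Y) = red(e_*P₀) − red(γ · e_*P₀) = Õ`
  have h2Y : (2 : ℤ) • geomReduction hΔ (e Y) = 0 := by
    have hYY : (2 : ℤ) • Y = P₀ - τ • P₀ := by
      rw [hY, zsmul_sub, h2s₀, ht₀]
      abel
    rw [← map_zsmul, ← map_zsmul, hYY, map_sub, map_sub, ← hequiv,
      geomReduction_smul_of_mem_inertia hΔ hmem hγI, sub_self]
  -- `red(e_*Y) = red(e_*(s − s₀))` has odd order: contradiction
  have hssfin : IsOfFinAddOrder (s - s₀) := by
    rw [← AddCommGroup.mem_torsion]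
    exact (AddCommGroup.torsion _).sub_mem ((AddCommGroup.mem_torsion _).mpr hsfin)
      ((AddCommGroup.mem_torsion _).mpr hs₀fin)
  have hsodd : Odd (addOrderOf (s - s₀)) := odd_addOrderOf_of_two_torsionFree hssfin fun k hk ↦ h2K _ hk
  have hredeq : geomReduction hΔ (e Y) = geomReduction hΔ (e (s - s₀)) := by
    have h' : geomReduction hΔ (e P₀) = geomReduction hΔ (e s) := by rw [he]; exact hred
    rw [hY, map_sub, map_sub, h', ← map_sub, ← map_sub]
  have hodd' : Odd (addOrderOf (geomReduction hΔ (e Y))) := by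
    rw [hredeq]
    exact hsodd.of_dvd_nat ((addOrderOf_map_dvd (geomReduction hΔ) _).trans (addOrderOf_map_dvd e _))
  apply hredY
  rw [← he]
  exact eq_zero_of_two_smul_eq_zero_of_odd_addOrderOf h2Y hodd'

/-- **K₁ ⟹ R₁, in the LITERAL shape of the binder `hR1`** of `DepthZero.nonCMAtTwo_of_items_of_reductionBits` at a prime Heegner
field: the existential `∃ ℓ ∣ d_K, ℓ ∤ Δ_min(W), ∃ P₀ ↦ P(1), ∀ Aut-fixed torsion s, red_𝔓(e_*P₀) ≠ red_𝔓(e_*s)` from K₁ (`y_K ∉ 2E(K[1])`)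
on the `#Sel₂(E) = 1` cell. [cite: GrossLMS1991, §5 Prop. 5.3] [cite: MazurRubin2010, Prop. 3.3, Cor. 3.4 (i)] -/
theorem exists_reductionBit_of_not_two_dvd_derivedPoint_prime (W : WeierstrassCurve ℚ) [W.IsElliptic] [W.IsGloballyMinimal]
    [NeZero (W.conductorNorm ℤ)] (hΔneg : W.Δ < 0) (hr0 : W.analyticRank = 0) (hρ : W.HasSurjectiveModNGaloisRep 2)
    (h1 : Nat.card (W.selmerGroup 2) = 1)
    (hK : IsImaginaryQuadratic K) (hH : SatisfiesHeegnerHypothesis (W.conductorNorm ℤ) K)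
    (hsq : ¬ IsSquare ((NumberField.discr K : ℚ) * W.Δ))
    {ℓ : ℕ} (hℓ : ℓ.Prime) (hℓ2 : ℓ ≠ 2) (hd : NumberField.discr K = -(ℓ : ℤ))
    (Dt : ModularParametrizationData W (W.conductorNorm ℤ)) (β : ℤ) (ι : K →+* ℂ) (d₁ : KolyvaginHeegnerData Dt β ι 1)
    (hK1 : ¬ ∃ Q : (W.baseChange (ringClassField K ι 1)).toAffine.Point, (2 : ℤ) • Q = d₁.derivedPoint) :
    ∃ (ℓ : ℕ) (_ : Fact ℓ.Prime) (_ : (ℓ : ℤ) ∣ NumberField.discr K) (hΔ : ¬ (ℓ : ℤ) ∣ minimalDiscriminantInt W)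
      (P₀ : (W.baseChange K).toAffine.Point),
      Affine.Point.map (W' := W) (algebraMap K (ringClassField K ι 1)).toRatAlgHom P₀ = d₁.derivedPoint ∧
      ∀ s : (W.baseChange K).toAffine.Point, IsOfFinAddOrder s → (∀ σ : K ≃ₐ[ℚ] K, σ • s = s) →
        geomReduction hΔ (Affine.Point.map (W' := W) (absEmbedding ℚ K) P₀ : W.geomPoints) ≠
          geomReduction hΔ (Affine.Point.map (W' := W) (absEmbedding ℚ K) s : W.geomPoints) := by
  haveI : Fact ℓ.Prime := ⟨hℓ⟩
  obtain ⟨hΔ, P₀, hP₀, hred⟩ :=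
    reductionBit_of_not_two_dvd_derivedPoint_prime W hΔneg hr0 hρ h1 hK hH hsq hℓ2 hd Dt β ι d₁ hK1
  exact ⟨ℓ, ⟨hℓ⟩, ⟨-1, by rw [hd]; ring⟩, hΔ, P₀, hP₀, hred⟩

end Summit.BirchSwinnertonDyer.BirchSwinnertonDyer.Theorems.GenusSupplyNarrow.DepthZero

end
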